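import Summits.CriticalPhenomena.PercolationContinuityZ3.Theorems.PercNearOneGluingNoHeavyLowerTailSahiSlotPatternBridge

/-!
# The slot-pattern kernel with a pinned slot, I: the insertion recursion of the diagonal form and the LINK REDUCTION at every order

Support file of the one-cut programme (crux `NoHeavyLowerTail`, stmt-CriticalPhenomena-4575; cell `prim-masterthm`, seat P3, gen 29;
`run/shared/lean/prim/prim-masterthm/prim-masterthm-p3/HIERARCHY.md` §36).  Vocabulary of `…SahiSlotPatternBridge` (gen 18): the slot cube
`Q d n = Fin d → Fin n`, `diag`, `act`, cycle representatives `rep σ i` (least element of the cycle), the diagonal form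
`diagForm d n h = Σ_σ (−1)^{C_σ−1} Π_i h_i(diag(rep σ i))` and the pattern functional `patternForm d n h = Σ_{τ ∈ S_n^d} diagForm(h ∘ τ)`.

* `rep_eq_of_mem_of_le`, `rep_zero`, `rep_decomposeFin_zero_succ`, `rep_decomposeFin_succ_succ` — cycle representatives along Mathlib's
  `Equiv.Perm.decomposeFin` ("drop `0` from its cycle"; the cycle bookkeeping is `Literature…Sahi2008.CycleForm.orbit_decomposeFin_*`);
* **`diagForm_succ_succ`** — the Lieb–Sahi insertion recursion READ POINTWISE on the slot cube: with slot `0` distinguished,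
  `D_{N+2}(h) = h_0(diag 0) · Σ_{τ ∈ S_{N+1}} (−1)^{C_τ−1} [ Σ_e Π_{i ∈ cycle of e} h_{i+1}(diag 0) · Π_{i ∉ cycle of e} h_{i+1}(diag(rep τ i + 1))
   − Π_i h_{i+1}(diag(rep τ i + 1)) ]`
  (`σ(0) = e+1`: the cycle of `e` receives `0` and is read at the diagonal point `0`; `σ(0) = 0`: an extra one-cycle, sign flip);
* **`sum_lperm_eq_sum_point_link`** — THE LINK REDUCTION at every order: a Latin `(N+1)`-tuple of `[N+1]^d` (one permutation per axis) is its
  first point `m` together with a Latin `N`-tuple of the LINK `[N]^d ↪ [N+1]^d`, `q ↦ (m_a.succAbove q_a)_a` (per axis the bijection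
  `(p, π) ↦ (0 ↦ p, j+1 ↦ p.succAbove (π j))` of `Fin (N+1) × Perm (Fin N)` with `Perm (Fin (N+1))`, written with Mathlib's `finSuccEquiv'`);
  `act_ext_diag_zero`, `act_ext_diag_succ` — the points of the extended tuple.
The sequel `…SahiSlotPinnedCharge` combines these with the cycle-weight identity (`…SahiSlotCycleWeights`) into the top-cell identity and the
monotonicity of the pinned kernel ("charge") at every order.  No definitions; everything proved; axioms standard. [this work]
-/

noncomputable section

namespace Summit.CriticalPhenomena.PercolationContinuityZ3.Theorems

open Finset Function Equiv Equiv.Perm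
open Literature.Combinatorics.Sahi2008 Literature.Combinatorics.Sahi2008.CycleForm

namespace SahiSlot

/-! ### Cycle representatives along `decomposeFin` -/

section RepLemmas

variable {n : ℕ}

/-- Characterisation of the representative: the least element of the cycle. [this work] -/
theorem rep_eq_of_mem_of_le {σ : Perm (Fin n)} {j x : Fin n} (hx : x ∈ orbit σ j) (hle : ∀ y ∈ orbit σ j, x ≤ y) :
    rep σ j = x :=
  le_antisymm (Finset.min'_le _ _ hx) (Finset.le_min' _ _ _ hle)

/-- The representative is below every element of the cycle. [this work] -/
theorem rep_le_of_mem {σ : Perm (Fin n)} {j y : Fin n} (hy : y ∈ orbit σ j) : rep σ j ≤ y :=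
  Finset.min'_le _ _ hy

/-- `0` represents its own cycle. [this work] -/
theorem rep_zero (σ : Perm (Fin (n + 1))) : rep σ 0 = 0 :=
  rep_eq_of_mem_of_le (self_mem_orbit σ 0) fun y _ => Fin.zero_le y

/-- `σ(0) = 0`: the representatives of the shifted cycles are the shifted representatives. [this work] -/
theorem rep_decomposeFin_zero_succ (τ : Perm (Fin n)) (i : Fin n) :
    rep (decomposeFin.symm (0, τ)) i.succ = (rep τ i).succ := by
  refine rep_eq_of_mem_of_le ?_ ?_
  · rw [orbit_decomposeFin_zero_succ, mem_map]
    exact ⟨rep τ i, rep_mem τ i, rfl⟩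
  · intro y hy
    rw [orbit_decomposeFin_zero_succ, mem_map] at hy
    obtain ⟨y', hy', rfl⟩ := hy
    exact Fin.succ_le_succ_iff.2 (rep_le_of_mem hy')

/-- `σ(0) = e+1`: the cycle of `e` receives `0` (representative `0`), the other representatives are shifted. [this work] -/
theorem rep_decomposeFin_succ_succ (τ : Perm (Fin n)) (e i : Fin n) :
    rep (decomposeFin.symm (e.succ, τ)) i.succ = if e ∈ orbit τ i then 0 else (rep τ i).succ := by
  have horb := orbit_decomposeFin_succ_succ τ e i
  unfold liftBlock at horb
  split_ifs with he
  · rw [if_pos he] at horb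
    refine rep_eq_of_mem_of_le ?_ fun y _ => Fin.zero_le y
    rw [horb]
    exact mem_insert_self _ _
  · rw [if_neg he] at horb
    refine rep_eq_of_mem_of_le ?_ ?_
    · rw [horb, mem_map]
      exact ⟨rep τ i, rep_mem τ i, rfl⟩
    · intro y hy
      rw [horb, mem_map] at hy
      obtain ⟨y', hy', rfl⟩ := hy
      exact Fin.succ_le_succ_iff.2 (rep_le_of_mem hy')

/-- The points whose cycle contains `e` form the cycle of `e`. [folklore] -/
theorem filter_mem_orbit_eq (τ : Perm (Fin n)) (e : Fin n) : univ.filter (fun i => e ∈ orbit τ i) = orbit τ e := by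
  ext i
  simp only [mem_filter, mem_univ, true_and, mem_orbit]
  exact ⟨fun h => h.symm, fun h => h.symm⟩

/-- A permutation of a nonempty `Fin (n+1)` has at least one cycle. [folklore] -/
theorem card_orbits_pos' (τ : Perm (Fin (n + 1))) : 0 < (orbits τ).card :=
  card_pos.2 ⟨_, orbit_mem_orbits τ 0⟩

end RepLemmas

/-! ### The insertion recursion of the diagonal form -/

section Recursion

variable {d N : ℕ}

/-- **The Lieb–Sahi insertion recursion, read pointwise on the slot cube** (slot `0` distinguished):
`D_{N+2}(h) = h_0(diag 0) · Σ_τ (−1)^{C_τ−1} [ Σ_e (Π_{i ∈ cycle_τ e} h_{i+1}(diag 0)) (Π_{i ∉ cycle_τ e} h_{i+1}(diag(rep τ i+1))) − Π_i h_{i+1}(diag(rep τ i+1)) ]`.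
[this work] -/
theorem diagForm_succ_succ (h : Fin (N + 2) → Q d (N + 2) → ℝ) :
    diagForm d (N + 2) h = h 0 (diag 0) * ∑ τ : Perm (Fin (N + 1)), (-1 : ℝ) ^ ((orbits τ).card - 1) *
      ((∑ e : Fin (N + 1), (∏ i ∈ orbit τ e, h i.succ (diag 0)) * ∏ i ∈ univ \ orbit τ e, h i.succ (diag (rep τ i).succ))
        - ∏ i : Fin (N + 1), h i.succ (diag (rep τ i).succ)) := by
  unfold diagForm
  rw [← Equiv.sum_comp decomposeFin.symm, Fintype.sum_prod_type, Fin.sum_univ_succ]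
  -- `σ(0) = 0`
  have h0 : ∑ τ : Perm (Fin (N + 1)), (-1 : ℝ) ^ ((orbits (decomposeFin.symm (0, τ))).card - 1) *
      ∏ i, h i (diag (rep (decomposeFin.symm (0, τ)) i)) =
      h 0 (diag 0) * ∑ τ : Perm (Fin (N + 1)), (-1 : ℝ) ^ ((orbits τ).card - 1) *
        (-∏ i : Fin (N + 1), h i.succ (diag (rep τ i).succ)) := by
    rw [mul_sum]
    refine sum_congr rfl fun τ _ => ?_
    rw [card_orbits_decomposeFin_zero, Nat.add_sub_cancel, Fin.prod_univ_succ, rep_zero]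
    simp only [rep_decomposeFin_zero_succ]
    obtain ⟨c, hc⟩ : ∃ c, (orbits τ).card = c + 1 := ⟨(orbits τ).card - 1, (Nat.sub_add_cancel (card_orbits_pos' τ)).symm⟩
    rw [hc, Nat.add_sub_cancel, pow_succ]
    ring
  -- `σ(0) = e+1`
  have h1 : ∀ e : Fin (N + 1), ∑ τ : Perm (Fin (N + 1)), (-1 : ℝ) ^ ((orbits (decomposeFin.symm (e.succ, τ))).card - 1) *
      ∏ i, h i (diag (rep (decomposeFin.symm (e.succ, τ)) i)) =
      h 0 (diag 0) * ∑ τ : Perm (Fin (N + 1)), (-1 : ℝ) ^ ((orbits τ).card - 1) *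
        ((∏ i ∈ orbit τ e, h i.succ (diag 0)) * ∏ i ∈ univ \ orbit τ e, h i.succ (diag (rep τ i).succ)) := by
    intro e
    rw [mul_sum]
    refine sum_congr rfl fun τ _ => ?_
    rw [card_orbits_decomposeFin_succ, Fin.prod_univ_succ, rep_zero]
    simp only [rep_decomposeFin_succ_succ]
    have hp : ∏ i : Fin (N + 1), h i.succ (diag (if e ∈ orbit τ i then (0 : Fin (N + 2)) else (rep τ i).succ)) =
        (∏ i ∈ orbit τ e, h i.succ (diag 0)) * ∏ i ∈ univ \ orbit τ e, h i.succ (diag (rep τ i).succ) := by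
      have e1 : ∀ i : Fin (N + 1), h i.succ (diag (if e ∈ orbit τ i then (0 : Fin (N + 2)) else (rep τ i).succ)) =
          if e ∈ orbit τ i then h i.succ (diag 0) else h i.succ (diag (rep τ i).succ) := fun i => by
        split_ifs <;> rfl
      rw [Fintype.prod_congr _ _ e1, prod_ite, filter_mem_orbit_eq]
      congr 1
      refine prod_congr ?_ fun _ _ => rfl
      ext i
      simp only [mem_filter, mem_univ, true_and, mem_sdiff, mem_orbit]
      exact not_congr ⟨fun hs => hs.symm, fun hs => hs.symm⟩
    rw [hp]
    ring
  rw [h0, sum_congr rfl fun e _ => h1 e, ← mul_sum, ← mul_add]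
  congr 1
  rw [sum_comm, ← sum_add_distrib]
  refine sum_congr rfl fun τ _ => ?_
  rw [mul_sub, mul_sum]
  ring

end Recursion

/-! ### The link reduction at every order -/

section Link

variable {d N : ℕ}

/-- The per-axis extension `[0 ↦ p, j+1 ↦ p.succAbove (π j)]` of `(p, π) ∈ Fin (N+1) × Perm (Fin N)` sends `0` to `p`. [this work] -/
theorem ext_apply_zero (p : Fin (N + 1)) (π : Perm (Fin N)) :
    ((finSuccEquiv' (0 : Fin (N + 1))).trans ((Equiv.optionCongr π).trans (finSuccEquiv' p).symm)) 0 = p := by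
  simp

/-- … and `j+1` to `p.succAbove (π j)`. [this work] -/
theorem ext_apply_succ (p : Fin (N + 1)) (π : Perm (Fin N)) (j : Fin N) :
    ((finSuccEquiv' (0 : Fin (N + 1))).trans ((Equiv.optionCongr π).trans (finSuccEquiv' p).symm)) j.succ =
      p.succAbove (π j) := by
  have h1 : (finSuccEquiv' (0 : Fin (N + 1))) j.succ = some j := by
    rw [show j.succ = (0 : Fin (N + 1)).succAbove j by simp]
    exact finSuccEquiv'_succAbove 0 j
  simp [h1]

/-- `(p, π) ↦ [0 ↦ p, j+1 ↦ p.succAbove (π j)]` is a bijection of `Fin (N+1) × Perm (Fin N)` with `Perm (Fin (N+1))`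
(injective; both sides have `(N+1)!` elements). [this work] -/
theorem ext_bijective : Function.Bijective (fun pπ : Fin (N + 1) × Perm (Fin N) =>
    (finSuccEquiv' (0 : Fin (N + 1))).trans ((Equiv.optionCongr pπ.2).trans (finSuccEquiv' pπ.1).symm)) := by
  rw [Fintype.bijective_iff_injective_and_card]
  refine ⟨?_, ?_⟩
  · rintro ⟨p, π⟩ ⟨p', π'⟩ h
    have h0 := congrArg (fun σ : Perm (Fin (N + 1)) => σ 0) h
    simp only [ext_apply_zero] at h0
    subst h0
    have hj : ∀ j, π j = π' j := fun j => by
      have h' := congrArg (fun σ : Perm (Fin (N + 1)) => σ j.succ) h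
      simp only [ext_apply_succ] at h'
      exact Fin.succAbove_right_injective h'
    rw [Prod.mk.injEq]
    exact ⟨rfl, Equiv.ext hj⟩
  · rw [Fintype.card_prod, Fintype.card_fin, Fintype.card_perm, Fintype.card_perm, Fintype.card_fin, Fintype.card_fin,
      Nat.factorial_succ]

/-- **The link reduction**: a Latin sum over `S_{N+1}^d` is a sum over the first point `m ∈ [N+1]^d` and the Latin tuples of its link.
[this work] -/
theorem sum_lperm_eq_sum_point_link (G : (Fin d → Perm (Fin (N + 1))) → ℝ) :
    ∑ τ : Fin d → Perm (Fin (N + 1)), G τ =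
      ∑ m : Q d (N + 1), ∑ τ' : Fin d → Perm (Fin N),
        G (fun a => (finSuccEquiv' (0 : Fin (N + 1))).trans ((Equiv.optionCongr (τ' a)).trans (finSuccEquiv' (m a)).symm)) := by
  have hΨ : Function.Bijective (fun p : Q d (N + 1) × (Fin d → Perm (Fin N)) => fun a =>
      (finSuccEquiv' (0 : Fin (N + 1))).trans ((Equiv.optionCongr (p.2 a)).trans (finSuccEquiv' (p.1 a)).symm)) := by
    rw [Fintype.bijective_iff_injective_and_card]
    refine ⟨?_, ?_⟩
    · rintro ⟨m, τ'⟩ ⟨m'', τ''⟩ h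
      have ha : ∀ a, (m a, τ' a) = (m'' a, τ'' a) := fun a =>
        ext_bijective.1 (congrFun h a)
      rw [Prod.mk.injEq]
      exact ⟨funext fun a => (Prod.mk.inj (ha a)).1, funext fun a => (Prod.mk.inj (ha a)).2⟩
    · rw [Fintype.card_prod, Fintype.card_fun, Fintype.card_fun, Fintype.card_fun, Fintype.card_fin, Fintype.card_fin,
        Fintype.card_perm, Fintype.card_perm, Fintype.card_fin, Fintype.card_fin, Nat.factorial_succ, mul_pow]
  rw [← Equiv.sum_comp (Equiv.ofBijective _ hΨ), Fintype.sum_prod_type]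
  rfl

/-- The first point of the extended Latin tuple is `m`. [this work] -/
theorem act_ext_diag_zero (m : Q d (N + 1)) (τ' : Fin d → Perm (Fin N)) :
    act (fun a => (finSuccEquiv' (0 : Fin (N + 1))).trans ((Equiv.optionCongr (τ' a)).trans (finSuccEquiv' (m a)).symm))
      (diag 0) = m := by
  funext a
  simp only [act, diag]
  exact ext_apply_zero (m a) (τ' a)

/-- The later points of the extended Latin tuple are the points of the Latin tuple `τ'` of the link, embedded by `succAbove`
coordinatewise. [this work] -/
theorem act_ext_diag_succ (m : Q d (N + 1)) (τ' : Fin d → Perm (Fin N)) (j : Fin N) :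
    act (fun a => (finSuccEquiv' (0 : Fin (N + 1))).trans ((Equiv.optionCongr (τ' a)).trans (finSuccEquiv' (m a)).symm))
      (diag j.succ) = fun a => (m a).succAbove (act τ' (diag j) a) := by
  funext a
  simp only [act, diag]
  exact ext_apply_succ (m a) (τ' a) j

end Link



end SahiSlot

end Summit.CriticalPhenomena.PercolationContinuityZ3.Theorems
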